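import Summits.MatrixMultiplication.MatrixMultiplication.Theorems.ObstructionDescentLeviWeylLaw

set_option linter.dupNamespace false

/-!
# Block-Levi invariance of the level sets `E′_N(x)` (decomp-mm · lens 3 · gen 14, part C)

Route `route-MatrixMultiplication-ObstructionDescent`, support for the aside `InvariantSaturation` (item
`stmt-MatrixMultiplication-32282`); continues `ObstructionDescentLeviWeylLaw`.

`ObstructionDescentLeviWeylLaw` proves that the level set `pointLevels N x` of a point `x ∈ ℂ^m ⊗ ℂ^m ⊗ ℂ^m`
(the levels `k` for which some `((k^N))³`-weight vector of degree `kN` does not vanish at `x`) is invariant, in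
each slot, under the GENERATORS of the block Levi subgroup `GL_{m-N} × GL_N ≤ GL_m` of the corner format `N`:
invertible diagonal matrices (Borel moves, (D₁)) and the root groups `E_{ij}(u)` with both indices in the corner
block or both outside it ((D₂)).  `ObstructionDescentUnitParity` assembles these at the first cell `N = m`, where
the Levi is all of `GL_m`.  This file assembles them at EVERY format `N ≤ m`:

* `pointLevels_slotAct_blockLevi` — for an invertible matrix `X` that is block-diagonal with respect to the
  partition `{a | m ≤ a + N} ⊔ {a | a + N < m}` of the indices, `pointLevels N (slotAct s X t) = pointLevels N t`;
* `pointLevels_actTensor_blockLevi` — the same for a triple `(A, B, C)` of such matrices;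
* `pointLevels_slotAct_blockParabolic` — the same for the whole PARABOLIC `P_N` (invertible, block upper
  triangular: corner rows vanish outside the corner columns), i.e. `E′_N` is an invariant of the `P_N³`-orbit.

The assembly is Mathlib's `Matrix.diagonal_transvection_induction_of_det_ne_zero` run on each block (an index
SUBTYPE), transported to `Fin m` through the lift `Y ↦ Y ⊕ 1` (`liftBlock`, a reindexed `Matrix.fromBlocks`):
the lift is multiplicative, carries transvections of the block to transvections of `Fin m` with both indices in
the block (`Matrix.TransvectionStruct.toMatrix_sumInl` + `toMatrix_reindexEquiv`) and invertible diagonal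
matrices to Borel matrices; a block upper triangular `X` factors as (lift of its corner block) · (block shear,
a unipotent Borel matrix) · (lift of its complementary block) — no inverse is taken — and a block-diagonal one
is the special case with zero shear.
No new facts are cited; every `def` is an explicit matrix or a set of matrices.
[cite: BurgisserIkenmeyer2011, §3.1–3.2] (weight vectors as Borel eigenvectors), [cite: BurgisserIkenmeyer2017, §5 (5.2)]
(the level sets `E′`).
-/

open scoped BigOperators
open Finset

namespace Summit.MatrixMultiplication.MatrixMultiplication.Theorems.ObstructionCalculus

open Literature.Computability.AlgebraicComplexity (actTensor actTensor_actTensor)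

section BlockLevi

variable {m : ℕ}
variable (p : Fin m → Prop) [DecidablePred p]

/-! ### 1 · Lifting a matrix on an index class to `Fin m` -/

/-- The lift `Y ↦ Y ⊕ 1` of a matrix on the index class `{a // p a}` to `Fin m`: `Y` on the class, the identity
on the complementary class, zero across. [bookkeeping] -/
def liftBlock (Y : Matrix {a // p a} {a // p a} ℂ) : Matrix (Fin m) (Fin m) ℂ :=
  Matrix.reindex (Equiv.sumCompl p) (Equiv.sumCompl p) (Matrix.fromBlocks Y 0 0 1)

/-- The complementary lift `Z ↦ 1 ⊕ Z` of a matrix on the class `{a // ¬ p a}`. [bookkeeping] -/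
def liftBlockC (Z : Matrix {a // ¬ p a} {a // ¬ p a} ℂ) : Matrix (Fin m) (Fin m) ℂ :=
  Matrix.reindex (Equiv.sumCompl p) (Equiv.sumCompl p) (Matrix.fromBlocks 1 0 0 Z)

/-- Entries of the lift. [bookkeeping] -/
theorem liftBlock_apply (Y : Matrix {a // p a} {a // p a} ℂ) (a b : Fin m) :
    liftBlock p Y a b =
      if ha : p a then (if hb : p b then Y ⟨a, ha⟩ ⟨b, hb⟩ else 0)
      else (if p b then 0 else if a = b then 1 else 0) := by
  unfold liftBlock
  rw [Matrix.reindex_apply, Matrix.submatrix_apply]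
  by_cases ha : p a <;> by_cases hb : p b
  · rw [Equiv.sumCompl_symm_apply_of_pos ha, Equiv.sumCompl_symm_apply_of_pos hb,
      Matrix.fromBlocks_apply₁₁, dif_pos ha, dif_pos hb]
  · rw [Equiv.sumCompl_symm_apply_of_pos ha, Equiv.sumCompl_symm_apply_of_neg hb,
      Matrix.fromBlocks_apply₁₂, dif_pos ha, dif_neg hb, Matrix.zero_apply]
  · rw [Equiv.sumCompl_symm_apply_of_neg ha, Equiv.sumCompl_symm_apply_of_pos hb,
      Matrix.fromBlocks_apply₂₁, dif_neg ha, if_pos hb, Matrix.zero_apply]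
  · rw [Equiv.sumCompl_symm_apply_of_neg ha, Equiv.sumCompl_symm_apply_of_neg hb,
      Matrix.fromBlocks_apply₂₂, dif_neg ha, if_neg hb, Matrix.one_apply]
    by_cases hab : a = b
    · subst hab
      rw [if_pos rfl, if_pos rfl]
    · rw [if_neg hab, if_neg]
      exact fun h => hab (congrArg Subtype.val h)

/-- Entries of the complementary lift. [bookkeeping] -/
theorem liftBlockC_apply (Z : Matrix {a // ¬ p a} {a // ¬ p a} ℂ) (a b : Fin m) :
    liftBlockC p Z a b =
      if ha : ¬ p a then (if hb : ¬ p b then Z ⟨a, ha⟩ ⟨b, hb⟩ else 0)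
      else (if ¬ p b then 0 else if a = b then 1 else 0) := by
  unfold liftBlockC
  rw [Matrix.reindex_apply, Matrix.submatrix_apply]
  by_cases ha : p a <;> by_cases hb : p b
  · rw [Equiv.sumCompl_symm_apply_of_pos ha, Equiv.sumCompl_symm_apply_of_pos hb,
      Matrix.fromBlocks_apply₁₁, dif_neg (not_not_intro ha), if_neg (not_not_intro hb), Matrix.one_apply]
    by_cases hab : a = b
    · subst hab
      rw [if_pos rfl, if_pos rfl]
    · rw [if_neg hab, if_neg]
      exact fun h => hab (congrArg Subtype.val h)
  · rw [Equiv.sumCompl_symm_apply_of_pos ha, Equiv.sumCompl_symm_apply_of_neg hb,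
      Matrix.fromBlocks_apply₁₂, dif_neg (not_not_intro ha), if_pos hb, Matrix.zero_apply]
  · rw [Equiv.sumCompl_symm_apply_of_neg ha, Equiv.sumCompl_symm_apply_of_pos hb,
      Matrix.fromBlocks_apply₂₁, dif_pos ha, dif_neg (not_not_intro hb), Matrix.zero_apply]
  · rw [Equiv.sumCompl_symm_apply_of_neg ha, Equiv.sumCompl_symm_apply_of_neg hb,
      Matrix.fromBlocks_apply₂₂, dif_pos ha, dif_pos hb]

/-- The complementary lift is the lift for the complementary class. [bookkeeping] -/
theorem liftBlockC_eq (Z : Matrix {a // ¬ p a} {a // ¬ p a} ℂ) :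
    liftBlockC p Z = liftBlock (fun a => ¬ p a) Z := by
  ext a b
  rw [liftBlockC_apply, liftBlock_apply]

/-- The lift is multiplicative. [bookkeeping] -/
theorem liftBlock_mul (Y Y' : Matrix {a // p a} {a // p a} ℂ) :
    liftBlock p (Y * Y') = liftBlock p Y * liftBlock p Y' := by
  unfold liftBlock
  rw [Matrix.reindex_apply, Matrix.reindex_apply, Matrix.reindex_apply, Matrix.submatrix_mul_equiv,
    Matrix.fromBlocks_multiply]
  simp only [Matrix.mul_zero, Matrix.zero_mul, Matrix.mul_one, add_zero, zero_add]

/-- The lift preserves determinants. [bookkeeping] -/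
theorem det_liftBlock (Y : Matrix {a // p a} {a // p a} ℂ) : (liftBlock p Y).det = Y.det := by
  unfold liftBlock
  rw [Matrix.det_reindex_self, Matrix.det_fromBlocks_zero₂₁, Matrix.det_one, mul_one]

/-- The complementary lift preserves determinants. [bookkeeping] -/
theorem det_liftBlockC (Z : Matrix {a // ¬ p a} {a // ¬ p a} ℂ) : (liftBlockC p Z).det = Z.det := by
  unfold liftBlockC
  rw [Matrix.det_reindex_self, Matrix.det_fromBlocks_zero₂₁, Matrix.det_one, one_mul]

/-- The lift of a transvection of the class is the transvection of `Fin m` with the same (class) indices.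
[bookkeeping] -/
theorem liftBlock_transvection (τ : Matrix.TransvectionStruct {a // p a} ℂ) :
    liftBlock p τ.toMatrix = Matrix.transvection (τ.i : Fin m) (τ.j : Fin m) τ.c := by
  have h := Matrix.TransvectionStruct.toMatrix_reindexEquiv (Equiv.sumCompl p) (τ.sumInl {a // ¬ p a})
  rw [Matrix.TransvectionStruct.toMatrix_sumInl, Matrix.coe_reindexAlgEquiv] at h
  rw [liftBlock, ← h]
  rfl

/-- The lift of an invertible diagonal matrix of the class is a Borel matrix. [bookkeeping] -/
theorem liftBlock_diagonal_mem_borel {D : {a // p a} → ℂ} (hD : ∀ i, D i ≠ 0) :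
    liftBlock p (Matrix.diagonal D) ∈ borel m := by
  refine ⟨fun a b hba => ?_, fun a => ?_⟩
  · rw [liftBlock_apply]
    by_cases ha : p a <;> by_cases hb : p b
    · rw [dif_pos ha, dif_pos hb, Matrix.diagonal_apply_ne]
      exact fun h => (ne_of_gt hba) (congrArg Subtype.val h)
    · rw [dif_pos ha, dif_neg hb]
    · rw [dif_neg ha, if_pos hb]
    · rw [dif_neg ha, if_neg hb, if_neg (ne_of_gt hba)]
  · rw [liftBlock_apply]
    by_cases ha : p a
    · rw [dif_pos ha, dif_pos ha, Matrix.diagonal_apply_eq]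
      exact hD _
    · rw [dif_neg ha, if_neg ha, if_pos rfl]
      exact one_ne_zero

/-! ### 2 · Assembly on one block: transvection induction transported through the lift -/

/-- If the root groups with both indices in the class `p` leave the level sets of format `N` invariant (slot `s`),
then so does the lift of EVERY invertible matrix of the class: `GL` of the class is generated by its invertible
diagonal matrices and transvections (`Matrix.diagonal_transvection_induction_of_det_ne_zero`). [this node] -/
theorem pointLevels_slotAct_liftBlock (N : ℕ) (s : Fin 3)
    (hgen : ∀ i j : Fin m, i ≠ j → p i → p j → ∀ (u : ℂ) (t : Tensor ℂ m),
      pointLevels N (slotAct s (Matrix.transvection i j u) t) = pointLevels N t)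
    {Y : Matrix {a // p a} {a // p a} ℂ} (hY : Y.det ≠ 0) (t : Tensor ℂ m) :
    pointLevels N (slotAct s (liftBlock p Y) t) = pointLevels N t := by
  revert t
  refine Matrix.diagonal_transvection_induction_of_det_ne_zero
    (fun Y => ∀ t, pointLevels N (slotAct s (liftBlock p Y) t) = pointLevels N t) Y hY ?_ ?_ ?_
  · intro D hD t
    refine pointLevels_slotAct_borel N s (liftBlock_diagonal_mem_borel p fun i => ?_) t
    rw [Matrix.det_diagonal] at hD
    exact Finset.prod_ne_zero_iff.1 hD i (Finset.mem_univ i)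
  · intro τ t
    rw [liftBlock_transvection]
    exact hgen τ.i τ.j (fun h => τ.hij (Subtype.ext h)) τ.i.2 τ.j.2 τ.c t
  · intro A B _ _ hA hB t
    rw [liftBlock_mul, ← slotAct_mul _ _ t s, hA, hB]

/-! ### 3 · Block-triangular matrices: lift · block shear · lift -/

/-- The block shear `1 ⊕ 1 + C`: identity on both classes and the block `C` from the class `p` (columns) to the
complementary class (rows). [bookkeeping] -/
def blockShear (C : Matrix {a // ¬ p a} {a // p a} ℂ) : Matrix (Fin m) (Fin m) ℂ :=
  Matrix.reindex (Equiv.sumCompl p) (Equiv.sumCompl p) (Matrix.fromBlocks 1 0 C 1)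

/-- Entries of the block shear. [bookkeeping] -/
theorem blockShear_apply (C : Matrix {a // ¬ p a} {a // p a} ℂ) (a b : Fin m) :
    blockShear p C a b =
      if ha : p a then (if p b then (if a = b then 1 else 0) else 0)
      else (if hb : p b then C ⟨a, ha⟩ ⟨b, hb⟩ else if a = b then 1 else 0) := by
  unfold blockShear
  rw [Matrix.reindex_apply, Matrix.submatrix_apply]
  by_cases ha : p a <;> by_cases hb : p b
  · rw [Equiv.sumCompl_symm_apply_of_pos ha, Equiv.sumCompl_symm_apply_of_pos hb,
      Matrix.fromBlocks_apply₁₁, dif_pos ha, if_pos hb, Matrix.one_apply]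
    by_cases hab : a = b
    · subst hab
      rw [if_pos rfl, if_pos rfl]
    · rw [if_neg hab, if_neg]
      exact fun h => hab (congrArg Subtype.val h)
  · rw [Equiv.sumCompl_symm_apply_of_pos ha, Equiv.sumCompl_symm_apply_of_neg hb,
      Matrix.fromBlocks_apply₁₂, dif_pos ha, if_neg hb, Matrix.zero_apply]
  · rw [Equiv.sumCompl_symm_apply_of_neg ha, Equiv.sumCompl_symm_apply_of_pos hb,
      Matrix.fromBlocks_apply₂₁, dif_neg ha, dif_pos hb]
  · rw [Equiv.sumCompl_symm_apply_of_neg ha, Equiv.sumCompl_symm_apply_of_neg hb,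
      Matrix.fromBlocks_apply₂₂, dif_neg ha, dif_neg hb, Matrix.one_apply]
    by_cases hab : a = b
    · subst hab
      rw [if_pos rfl, if_pos rfl]
    · rw [if_neg hab, if_neg]
      exact fun h => hab (congrArg Subtype.val h)

/-- Block shears are unimodular. [bookkeeping] -/
theorem det_blockShear (C : Matrix {a // ¬ p a} {a // p a} ℂ) : (blockShear p C).det = 1 := by
  unfold blockShear
  rw [Matrix.det_reindex_self, Matrix.det_fromBlocks_zero₁₂, Matrix.det_one, Matrix.det_one, mul_one]

/-- A matrix whose `p`-rows vanish at the non-`p` columns factors as (lift of the `p`-block) · (block shear) ·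
(lift of the complementary block) — no inverse is needed. [bookkeeping] -/
theorem eq_liftBlock_mul_blockShear_mul_liftBlockC {X : Matrix (Fin m) (Fin m) ℂ}
    (hX : ∀ a b : Fin m, p a → ¬ p b → X a b = 0) :
    X = liftBlock p (X.toBlock p p) * blockShear p (X.toBlock (fun a => ¬ p a) p) *
      liftBlockC p (X.toBlock (fun a => ¬ p a) (fun a => ¬ p a)) := by
  unfold liftBlock blockShear liftBlockC
  rw [Matrix.reindex_apply, Matrix.reindex_apply, Matrix.reindex_apply, Matrix.submatrix_mul_equiv,
    Matrix.submatrix_mul_equiv, Matrix.fromBlocks_multiply, Matrix.fromBlocks_multiply]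
  simp only [Matrix.mul_zero, Matrix.zero_mul, Matrix.mul_one, Matrix.one_mul, add_zero, zero_add]
  ext a b
  rw [Matrix.submatrix_apply]
  by_cases ha : p a <;> by_cases hb : p b
  · rw [Equiv.sumCompl_symm_apply_of_pos ha, Equiv.sumCompl_symm_apply_of_pos hb,
      Matrix.fromBlocks_apply₁₁, Matrix.toBlock_apply]
  · rw [Equiv.sumCompl_symm_apply_of_pos ha, Equiv.sumCompl_symm_apply_of_neg hb,
      Matrix.fromBlocks_apply₁₂, Matrix.zero_apply]
    exact hX a b ha hb
  · rw [Equiv.sumCompl_symm_apply_of_neg ha, Equiv.sumCompl_symm_apply_of_pos hb,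
      Matrix.fromBlocks_apply₂₁, Matrix.toBlock_apply]
  · rw [Equiv.sumCompl_symm_apply_of_neg ha, Equiv.sumCompl_symm_apply_of_neg hb,
      Matrix.fromBlocks_apply₂₂, Matrix.toBlock_apply]

/-- Hence its determinant is the product of the two diagonal-block determinants. [bookkeeping] -/
theorem det_eq_of_blockTriangular {X : Matrix (Fin m) (Fin m) ℂ}
    (hX : ∀ a b : Fin m, p a → ¬ p b → X a b = 0) :
    X.det = (X.toBlock p p).det * (X.toBlock (fun a => ¬ p a) (fun a => ¬ p a)).det := by
  conv_lhs => rw [eq_liftBlock_mul_blockShear_mul_liftBlockC p hX]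
  rw [Matrix.det_mul, Matrix.det_mul, det_liftBlock, det_blockShear, det_liftBlockC, mul_one]

/-! ### 4 · The corner format `N`: parabolic and block Levi -/

variable (m) in
/-- The block Levi of the corner format `N` (as a set of matrices, invertibility NOT included): no entry joins a
corner index `a` (`m ≤ a + N`) to a non-corner index. [bookkeeping] -/
def blockLevi (N : ℕ) : Set (Matrix (Fin m) (Fin m) ℂ) :=
  {X | ∀ a b : Fin m, ¬ ((m ≤ (a : ℕ) + N) ↔ (m ≤ (b : ℕ) + N)) → X a b = 0}

/-- Membership in `blockLevi`. [bookkeeping] -/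
theorem mem_blockLevi {N : ℕ} {X : Matrix (Fin m) (Fin m) ℂ} :
    X ∈ blockLevi m N ↔ ∀ a b : Fin m, ¬ ((m ≤ (a : ℕ) + N) ↔ (m ≤ (b : ℕ) + N)) → X a b = 0 :=
  Iff.rfl

/-- For the CORNER class `{a | m ≤ a + N}` the block shear is a (unipotent) Borel matrix: the corner indices are
the last ones, so the shear block sits above the diagonal. [bookkeeping] -/
theorem blockShear_corner_mem_borel (N : ℕ)
    (C : Matrix {a : Fin m // ¬ (m ≤ (a : ℕ) + N)} {a : Fin m // m ≤ (a : ℕ) + N} ℂ) :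
    blockShear (fun a : Fin m => m ≤ (a : ℕ) + N) C ∈ borel m := by
  refine ⟨fun a b hba => ?_, fun a => ?_⟩
  · rw [blockShear_apply]
    by_cases ha : m ≤ (a : ℕ) + N <;> by_cases hb : m ≤ (b : ℕ) + N
    · rw [dif_pos ha, if_pos hb, if_neg (ne_of_gt hba)]
    · rw [dif_pos ha, if_neg hb]
    · exact absurd (le_trans hb (Nat.add_le_add_right (le_of_lt (Fin.lt_def.1 hba)) N)) ha
    · rw [dif_neg ha, dif_neg hb, if_neg (ne_of_gt hba)]
  · rw [blockShear_apply]
    by_cases ha : m ≤ (a : ℕ) + N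
    · rw [dif_pos ha, if_pos ha, if_pos rfl]
      exact one_ne_zero
    · rw [dif_neg ha, dif_neg ha, if_pos rfl]
      exact one_ne_zero

variable (m) in
/-- The parabolic of the corner format `N` (as a set of matrices, invertibility NOT included): block upper
triangular — the corner rows vanish at the non-corner columns.  It contains the Borel subgroup and the block
Levi. [bookkeeping] -/
def blockParabolic (N : ℕ) : Set (Matrix (Fin m) (Fin m) ℂ) :=
  {X | ∀ a b : Fin m, m ≤ (a : ℕ) + N → ¬ (m ≤ (b : ℕ) + N) → X a b = 0}

/-- Membership in `blockParabolic`. [bookkeeping] -/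
theorem mem_blockParabolic {N : ℕ} {X : Matrix (Fin m) (Fin m) ℂ} :
    X ∈ blockParabolic m N ↔ ∀ a b : Fin m, m ≤ (a : ℕ) + N → ¬ (m ≤ (b : ℕ) + N) → X a b = 0 :=
  Iff.rfl

/-- The block Levi lies in the parabolic. [bookkeeping] -/
theorem blockLevi_subset_blockParabolic (N : ℕ) : blockLevi m N ⊆ blockParabolic m N :=
  fun _ hX a b ha hb => hX a b fun h => hb (h.1 ha)

/-- The Borel subgroup lies in the parabolic (the corner indices are the last ones). [bookkeeping] -/
theorem borel_subset_blockParabolic (N : ℕ) : borel m ⊆ blockParabolic m N := by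
  intro X hX a b ha hb
  refine hX.1 a b (Fin.lt_def.2 (lt_of_not_ge fun hab => hb ?_))
  exact le_trans ha (Nat.add_le_add_right hab N)

/-- **(H14′) Parabolic invariance.** For every format `N` and slot `s`, the level set of a point is invariant under
every INVERTIBLE element of the parabolic `P_N ⊇ B_m, GL_{m-N} × GL_N` acting in slot `s`: `E′_N(x)` is an
invariant of the `P_N³`-orbit of `x`. [this node] -/
theorem pointLevels_slotAct_blockParabolic (N : ℕ) (s : Fin 3) {X : Matrix (Fin m) (Fin m) ℂ}
    (hX : X.det ≠ 0) (hP : X ∈ blockParabolic m N) (t : Tensor ℂ m) :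
    pointLevels N (slotAct s X t) = pointLevels N t := by
  have hP' : ∀ a b : Fin m, (fun a : Fin m => m ≤ (a : ℕ) + N) a → ¬ (fun a : Fin m => m ≤ (a : ℕ) + N) b →
      X a b = 0 := hP
  have hdet := det_eq_of_blockTriangular (fun a : Fin m => m ≤ (a : ℕ) + N) hP'
  have hA : (X.toBlock (fun a : Fin m => m ≤ (a : ℕ) + N) (fun a : Fin m => m ≤ (a : ℕ) + N)).det ≠ 0 := by
    intro h
    rw [h, zero_mul] at hdet
    exact hX hdet
  have hD : (X.toBlock (fun a : Fin m => ¬ (m ≤ (a : ℕ) + N)) (fun a : Fin m => ¬ (m ≤ (a : ℕ) + N))).det ≠ 0 := by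
    intro h
    rw [h, mul_zero] at hdet
    exact hX hdet
  rw [eq_liftBlock_mul_blockShear_mul_liftBlockC _ hP', ← slotAct_mul _ _ t s, ← slotAct_mul _ _ _ s,
    pointLevels_slotAct_liftBlock (fun a : Fin m => m ≤ (a : ℕ) + N) N s ?_ hA,
    pointLevels_slotAct_borel N s (blockShear_corner_mem_borel N _), liftBlockC_eq,
    pointLevels_slotAct_liftBlock (fun a : Fin m => ¬ (m ≤ (a : ℕ) + N)) N s ?_ hD]
  · intro i j hij hi hj u t'
    exact pointLevels_slotAct_transvection N s hij (iff_of_false hi hj) u t'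
  · intro i j hij hi hj u t'
    exact pointLevels_slotAct_transvection N s hij (iff_of_true hi hj) u t'

/-- **(H14′, three slots.)** The level set of a point is an invariant of its `P_N³`-orbit. [this node] -/
theorem pointLevels_actTensor_blockParabolic (N : ℕ) {A B C : Matrix (Fin m) (Fin m) ℂ}
    (hA : A.det ≠ 0) (hB : B.det ≠ 0) (hC : C.det ≠ 0)
    (hAP : A ∈ blockParabolic m N) (hBP : B ∈ blockParabolic m N) (hCP : C ∈ blockParabolic m N)
    (t : Tensor ℂ m) : pointLevels N (actTensor A B C t) = pointLevels N t := by
  have h : actTensor A B C t = slotAct 0 A (slotAct 1 B (slotAct 2 C t)) := by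
    simp only [slotAct_zero, slotAct_one, slotAct_two, actTensor_actTensor, Matrix.mul_one, Matrix.one_mul]
  rw [h, pointLevels_slotAct_blockParabolic N 0 hA hAP, pointLevels_slotAct_blockParabolic N 1 hB hBP,
    pointLevels_slotAct_blockParabolic N 2 hC hCP]

/-- **(H14) Block-Levi invariance.** For every format `N` and slot `s`, the level set of a point is invariant under
every INVERTIBLE element of the block Levi `GL_{m-N} × GL_N` acting in slot `s`. [this node] -/
theorem pointLevels_slotAct_blockLevi (N : ℕ) (s : Fin 3) {X : Matrix (Fin m) (Fin m) ℂ} (hX : X.det ≠ 0)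
    (hL : X ∈ blockLevi m N) (t : Tensor ℂ m) :
    pointLevels N (slotAct s X t) = pointLevels N t :=
  pointLevels_slotAct_blockParabolic N s hX (blockLevi_subset_blockParabolic N hL) t

/-- **(H14, three slots.)** The level set of a point is an invariant of its `(GL_{m-N} × GL_N)³`-orbit. [this node] -/
theorem pointLevels_actTensor_blockLevi (N : ℕ) {A B C : Matrix (Fin m) (Fin m) ℂ}
    (hA : A.det ≠ 0) (hB : B.det ≠ 0) (hC : C.det ≠ 0)
    (hAL : A ∈ blockLevi m N) (hBL : B ∈ blockLevi m N) (hCL : C ∈ blockLevi m N) (t : Tensor ℂ m) :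
    pointLevels N (actTensor A B C t) = pointLevels N t :=
  pointLevels_actTensor_blockParabolic N hA hB hC (blockLevi_subset_blockParabolic N hAL)
    (blockLevi_subset_blockParabolic N hBL) (blockLevi_subset_blockParabolic N hCL) t

end BlockLevi

end Summit.MatrixMultiplication.MatrixMultiplication.Theorems.ObstructionCalculus
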